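import Literature.NumberTheory.Automorphic.GLnLeviQuotientIwasawaIntegration
import Literature.NumberTheory.Automorphic.UnipotentRadicalCompactOpenProofs
import HarnessLib

/-!
# The unipotent radical `U_c(F)` of a standard parabolic of `GL_n(F)` is unimodular, and the
# Iwasawa form of invariant measures on `GL_n(F) ⧸ M_c(F)` for EVERY monotone block labelling

Topic `NumberTheory/Automorphic`; namespace `Literature.NumberTheory.Automorphic`. KERNEL
mathematics only: theorems, no definition, no named fact, no instance, no `sorry`. `F` a
non-archimedean local field, `c : Fin n → α` a MONOTONE block labelling (any number of blocks; for
`c = id` the standard parabolic is the Borel subgroup, `M_c = A` the diagonal torus and `U_c = N` the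
upper unitriangular group). The integration formula `GLnLeviQuotientIwasawaIntegration`
(`exists_quotientMeasure_levi_eq_smul_map`, `exists_integral_descConj_levi_eq_smul`) carries the
hypothesis `[μN.IsInvInvariant]` on the Haar measure of `U_c(F)`, discharged there for TWO blocks
only (`U_c` abelian). Here it is discharged in general: `U_c(F)` is the union of its compact open
subgroups (`isLimitOfCompactOpen_unipotentRadicalGL`, Bernstein–Zelevinsky 1977, §1.9), every element
lies in a compact subgroup, so the modular function is trivial
(`modularCharacterFun_eq_one_of_isCompact_subgroup`).

* §1 `modularCharacterFun_unipotentRadicalGL_eq_one`, `isMulRightInvariant_haar_unipotentRadicalGL_of_monotone`,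
  `isInvInvariant_haar_unipotentRadicalGL_of_monotone` — **`Δ_{U_c(F)} ≡ 1`; every Haar measure on
  `U_c(F)` is right invariant and inversion invariant**.
* §2 `mem_standardLeviGL_id_iff`, `mul_comm_of_mem_standardLeviGL_id` — for `c = id` the Levi
  subgroup is the diagonal torus `A`, which is commutative (so `T = A` centralises every `γ ∈ A`).
* §3 (`c = id`) `exists_quotientMeasure_torus_eq_smul_map`, `exists_integral_descConj_torus_eq_smul`
  — the two heads of `GLnLeviQuotientIwasawaIntegration` for the BOREL subgroup with the inversion
  hypothesis discharged: **`μ = C • ((k, n) ↦ k n A)_* (κ ⊗ μ_N)`** on `G ⧸ A` and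
  **`∫_{G ⧸ A} f(y γ y⁻¹) dμ = C ∫_{K × N} f((k n) γ (k n)⁻¹)`** for `γ ∈ A` (Gelbart 1975,
  Thm. 9.22 (iii), Remark 9.23: `∫_{A \ G} = ∫_N ∫_K`, now for `GL_n`); for other monotone `c` use
  the `GLnLeviQuotientIwasawaIntegration` heads with §1 directly.

## References

* [BernsteinZelevinsky1977] I. N. Bernstein, A. V. Zelevinsky, *Induced representations of reductive
  `p`-adic groups I*, Ann. Sci. ÉNS 10 (1977), §1.9, §2.1.
* [Gelbart1975] S. Gelbart, *Automorphic forms on adele groups* (1975), Thm. 9.22 (iii), Remark 9.23.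
* [GetzHahn2024] J. R. Getz, H. Hahn, *An Introduction to Automorphic Representations* (2024), §3.2.
-/

noncomputable section

open scoped MatrixGroups NNReal ENNReal
open MeasureTheory Measure Matrix Topology

namespace Literature.NumberTheory.Automorphic

open Literature.MeasureTheory.Group
open Literature.NumberTheory.GaloisRepresentations.IsNonarchimedeanLocalField

/-! ### 1. `U_c(F)` is unimodular -/

section Unimodular

variable (F : Type*) [Field F] [ValuativeRel F] [TopologicalSpace F] [IsNonarchimedeanLocalField F]
  {n : ℕ} {α : Type*} [LinearOrder α] {c : Fin n → α}

/-- **The modular function of `U_c(F)` is trivial** for a monotone block labelling `c`: every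
`u ∈ U_c(F)` lies in a compact open subgroup (`U_c(F)` is the union of its compact open subgroups,
`isLimitOfCompactOpen_unipotentRadicalGL`), and the modular function is trivial on compact subgroups
(`modularCharacterFun_eq_one_of_isCompact_subgroup`). (Bernstein–Zelevinsky 1977, §1.9; Getz–Hahn
2024, §3.2.) [cite: BernsteinZelevinsky1977, §1.9] -/
theorem modularCharacterFun_unipotentRadicalGL_eq_one (hc : Monotone c)
    [LocallyCompactSpace ↥(unipotentRadicalGL F c)] (u : ↥(unipotentRadicalGL F c)) :
    modularCharacterFun u = 1 := by
  haveI : T2Space F := (isLocalField F).toT2Space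
  haveI : SecondCountableTopology F := secondCountableTopology_localField F
  haveI : SecondCountableTopology (Matrix (Fin n) (Fin n) F) :=
    inferInstanceAs (SecondCountableTopology (Fin n → Fin n → F))
  haveI : SecondCountableTopology (Matrix (Fin n) (Fin n) F)ᵐᵒᵖ :=
    MulOpposite.opHomeomorph.symm.secondCountableTopology
  haveI : SecondCountableTopology (GL (Fin n) F) :=
    Units.isEmbedding_embedProduct.secondCountableTopology
  haveI : SecondCountableTopology ↥(unipotentRadicalGL F c) :=
    TopologicalSpace.Subtype.secondCountableTopology _
  letI mU : MeasurableSpace ↥(unipotentRadicalGL F c) := borel _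
  haveI : BorelSpace ↥(unipotentRadicalGL F c) := ⟨rfl⟩
  obtain ⟨K, -, hKc, huK⟩ :=
    isLimitOfCompactOpen_unipotentRadicalGL F c hc {u} isCompact_singleton
  exact modularCharacterFun_eq_one_of_isCompact_subgroup hKc (huK (Set.mem_singleton u))

/-- **`U_c(F)` is unimodular**: every Haar measure on `U_c(F)` is right invariant (any Borel
structure), for a monotone block labelling `c`. [cite: BernsteinZelevinsky1977, §1.9] -/
theorem isMulRightInvariant_haar_unipotentRadicalGL_of_monotone (hc : Monotone c)
    [MeasurableSpace ↥(unipotentRadicalGL F c)] [BorelSpace ↥(unipotentRadicalGL F c)]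
    (ν : Measure ↥(unipotentRadicalGL F c)) [IsHaarMeasure ν] : ν.IsMulRightInvariant := by
  haveI : T2Space F := (isLocalField F).toT2Space
  haveI : SecondCountableTopology F := secondCountableTopology_localField F
  haveI : LocallyCompactSpace F := (isLocalField F).toLocallyCompactSpace
  haveI : SecondCountableTopology (Matrix (Fin n) (Fin n) F) :=
    inferInstanceAs (SecondCountableTopology (Fin n → Fin n → F))
  haveI : SecondCountableTopology (Matrix (Fin n) (Fin n) F)ᵐᵒᵖ :=
    MulOpposite.opHomeomorph.symm.secondCountableTopology
  haveI : SecondCountableTopology (GL (Fin n) F) :=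
    Units.isEmbedding_embedProduct.secondCountableTopology
  haveI : SecondCountableTopology ↥(unipotentRadicalGL F c) :=
    TopologicalSpace.Subtype.secondCountableTopology _
  haveI : LocallyCompactSpace (Matrix (Fin n) (Fin n) F) :=
    inferInstanceAs (LocallyCompactSpace (Fin n → Fin n → F))
  haveI : LocallyCompactSpace ↥(unipotentRadicalGL F c) :=
    (isClosed_unipotentRadicalGL c).locallyCompactSpace
  exact isMulRightInvariant_of_modularCharacterFun_eq_one
    (modularCharacterFun_unipotentRadicalGL_eq_one F hc) ν

/-- **Every Haar measure on `U_c(F)` is invariant under `u ↦ u⁻¹`** (monotone `c`; unimodularity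
and `isInvInvariant_of_isMulRightInvariant`). This is the hypothesis `[μN.IsInvInvariant]` of
`exists_quotientMeasure_levi_eq_smul_map` for every standard parabolic, in particular for the Borel
subgroup (`c = id`, `U_c = N` the upper unitriangular group). [cite: BernsteinZelevinsky1977, §1.9] -/
theorem isInvInvariant_haar_unipotentRadicalGL_of_monotone (hc : Monotone c)
    [MeasurableSpace ↥(unipotentRadicalGL F c)] [BorelSpace ↥(unipotentRadicalGL F c)]
    (ν : Measure ↥(unipotentRadicalGL F c)) [IsHaarMeasure ν] : ν.IsInvInvariant := by
  haveI : T2Space F := (isLocalField F).toT2Space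
  haveI : SecondCountableTopology F := secondCountableTopology_localField F
  haveI : LocallyCompactSpace F := (isLocalField F).toLocallyCompactSpace
  haveI : SecondCountableTopology (Matrix (Fin n) (Fin n) F) :=
    inferInstanceAs (SecondCountableTopology (Fin n → Fin n → F))
  haveI : SecondCountableTopology (Matrix (Fin n) (Fin n) F)ᵐᵒᵖ :=
    MulOpposite.opHomeomorph.symm.secondCountableTopology
  haveI : SecondCountableTopology (GL (Fin n) F) :=
    Units.isEmbedding_embedProduct.secondCountableTopology
  haveI : SecondCountableTopology ↥(unipotentRadicalGL F c) :=
    TopologicalSpace.Subtype.secondCountableTopology _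
  haveI : LocallyCompactSpace (Matrix (Fin n) (Fin n) F) :=
    inferInstanceAs (LocallyCompactSpace (Fin n → Fin n → F))
  haveI : LocallyCompactSpace ↥(unipotentRadicalGL F c) :=
    (isClosed_unipotentRadicalGL c).locallyCompactSpace
  haveI : ν.IsMulRightInvariant := isMulRightInvariant_haar_unipotentRadicalGL_of_monotone F hc ν
  exact isInvInvariant_of_isMulRightInvariant ν

end Unimodular

/-! ### 2. `c = id`: the Levi subgroup is the (commutative) diagonal torus -/

section Torus

variable {R : Type*} [CommRing R] {m : Type*} [Fintype m] [DecidableEq m] [LinearOrder m]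

/-- For the finest labelling `c = id` the standard Levi subgroup of `GL_m(R)` is the **diagonal
torus**: `g ∈ M_{id} ↔ g_{ij} = 0` for `i ≠ j`. [cite: BernsteinZelevinsky1977, §2.1] -/
theorem mem_standardLeviGL_id_iff (g : GL m R) :
    g ∈ standardLeviGL R (id : m → m) ↔ ∀ i j, i ≠ j → (g : Matrix m m R) i j = 0 :=
  mem_standardLeviGL_iff (id : m → m) g

/-- **The diagonal torus is commutative**: two elements of `M_{id}` commute. (So, with `T = A` in
`GLnLeviOrbitalDescent` / `exists_integral_descConj_levi_eq_smul_of_monotone`, every `γ ∈ A` is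
centralised by `A`.) [cite: BernsteinZelevinsky1977, §2.1] -/
theorem mul_comm_of_mem_standardLeviGL_id {g h : GL m R} (hg : g ∈ standardLeviGL R (id : m → m))
    (hh : h ∈ standardLeviGL R (id : m → m)) : g * h = h * g := by
  rw [mem_standardLeviGL_id_iff] at hg hh
  apply Units.ext
  rw [Units.val_mul, Units.val_mul]
  ext i j
  rw [Matrix.mul_apply, Matrix.mul_apply, Finset.sum_eq_single i, Finset.sum_eq_single i]
  · by_cases hij : i = j
    · subst hij; exact mul_comm _ _
    · rw [hg i j hij, hh i j hij, mul_zero, mul_zero]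
  · intro k _ hki; rw [hh i k (Ne.symm hki), zero_mul]
  · intro hi; exact absurd (Finset.mem_univ i) hi
  · intro k _ hki; rw [hg i k (Ne.symm hki), zero_mul]
  · intro hi; exact absurd (Finset.mem_univ i) hi

end Torus

/-! ### 3. The Borel case `c = id`: invariant measures on `GL_n(F) ⧸ A` in `K × N` coordinates -/

section Borel

variable (F : Type*) [Field F] [ValuativeRel F] [TopologicalSpace F] [IsNonarchimedeanLocalField F]
  {n : ℕ} [MeasurableSpace (GL (Fin n) F)] [BorelSpace (GL (Fin n) F)]

/-- **Every invariant measure on `GL_n(F) ⧸ A` in the coordinates `K × N`** (`A = M_{id}` the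
diagonal torus, `N = U_{id}` the upper unitriangular group, `K = GL_n(𝒪)`): a non-zero `G`-invariant
measure `μ` on `G ⧸ A` finite on compact sets is `μ = C • ((k, n) ↦ k n A)_* (κ ⊗ μ_N)`, `C ≠ 0`, for
ANY Haar measures `κ` on `K` and `μ_N` on `N` (`exists_quotientMeasure_levi_eq_smul_map` at `c = id`
with `isInvInvariant_haar_unipotentRadicalGL_of_monotone`). (Gelbart 1975, Thm. 9.22 (iii):
"`dg = da dn dk`", here for `GL_n(F)`.) [cite: Gelbart1975, Thm. 9.22 (iii)] -/
theorem exists_quotientMeasure_torus_eq_smul_map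
    {A : Subgroup (GL (Fin n) F)} (hA : A = standardLeviGL F (id : Fin n → Fin n))
    [MeasurableSpace (GL (Fin n) F ⧸ A)] [BorelSpace (GL (Fin n) F ⧸ A)]
    (μ : Measure (GL (Fin n) F ⧸ A)) [SMulInvariantMeasure (GL (Fin n) F) (GL (Fin n) F ⧸ A) μ]
    [IsFiniteMeasureOnCompacts μ] (hμ : μ ≠ 0)
    (κ : Measure ↥(glInt n F)) [IsHaarMeasure κ]
    (μN : Measure ↥(unipotentRadicalGL F (id : Fin n → Fin n))) [IsHaarMeasure μN] :
    ∃ C : ℝ≥0, C ≠ 0 ∧ μ = C • Measure.map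
      (fun p : ↥(glInt n F) × ↥(unipotentRadicalGL F (id : Fin n → Fin n)) =>
        (QuotientGroup.mk ((p.1 : GL (Fin n) F) * (p.2 : GL (Fin n) F)) : GL (Fin n) F ⧸ A))
      (κ.prod μN) := by
  haveI : BorelSpace ↥(unipotentRadicalGL F (id : Fin n → Fin n)) := Subtype.borelSpace _
  haveI : μN.IsInvInvariant :=
    isInvInvariant_haar_unipotentRadicalGL_of_monotone F (c := (id : Fin n → Fin n)) monotone_id μN
  exact exists_quotientMeasure_levi_eq_smul_map F monotone_id hA μ hμ κ μN

/-- **The orbital integrand of a diagonal element over `GL_n(F) ⧸ A` in `K × N` coordinates**: ONE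
`C ≠ 0` with `∫_{G ⧸ A} f(y γ y⁻¹) dμ = C ∫_{K × N} f((k n) γ (k n)⁻¹) d(κ ⊗ μ_N)` for every
continuous `f` and every `γ` centralised by `A` (every `γ ∈ A`: `A` is commutative,
`mul_comm_of_mem_standardLeviGL_id`) — Gelbart's
`F^A_f(γ) = ∫_N ∫_K f(k⁻¹ n⁻¹ γ n k) dn dk` (1975, Remark 9.23), for `GL_n(F)` and every invariant `μ`.
[cite: Gelbart1975, Thm. 9.22 (iii) and Remark 9.23] -/
theorem exists_integral_descConj_torus_eq_smul
    {A : Subgroup (GL (Fin n) F)} (hA : A = standardLeviGL F (id : Fin n → Fin n))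
    [MeasurableSpace (GL (Fin n) F ⧸ A)] [BorelSpace (GL (Fin n) F ⧸ A)]
    (μ : Measure (GL (Fin n) F ⧸ A)) [SMulInvariantMeasure (GL (Fin n) F) (GL (Fin n) F ⧸ A) μ]
    [IsFiniteMeasureOnCompacts μ] (hμ : μ ≠ 0)
    (κ : Measure ↥(glInt n F)) [IsHaarMeasure κ]
    (μN : Measure ↥(unipotentRadicalGL F (id : Fin n → Fin n))) [IsHaarMeasure μN]
    {E : Type*} [NormedAddCommGroup E] [NormedSpace ℝ E] :
    ∃ C : ℝ≥0, C ≠ 0 ∧ ∀ (γ : GL (Fin n) F) (hγ : ∀ a ∈ A, a * γ = γ * a) (f : GL (Fin n) F → E),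
      Continuous f →
        ∫ y, descConj γ A hγ f y ∂μ =
          C • ∫ p : ↥(glInt n F) × ↥(unipotentRadicalGL F (id : Fin n → Fin n)),
            f ((p.1 : GL (Fin n) F) * (p.2 : GL (Fin n) F) * γ *
              ((p.1 : GL (Fin n) F) * (p.2 : GL (Fin n) F))⁻¹) ∂(κ.prod μN) := by
  haveI : BorelSpace ↥(unipotentRadicalGL F (id : Fin n → Fin n)) := Subtype.borelSpace _
  haveI : μN.IsInvInvariant :=
    isInvInvariant_haar_unipotentRadicalGL_of_monotone F (c := (id : Fin n → Fin n)) monotone_id μN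
  exact exists_integral_descConj_levi_eq_smul F monotone_id hA μ hμ κ μN

end Borel

end Literature.NumberTheory.Automorphic
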